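import Mathlib
import HarnessLib
import Summits.QuantumFields.YangMills.Theses.FemtoCutoffLadder
import Summits.QuantumFields.YangMills.Theorems.FemtoCutoffLadderMatchedCouplingExists
import Summits.QuantumFields.YangMills.Theorems.FemtoCutoffLadderEventualSplitGluePw
import Summits.QuantumFields.YangMills.Theorems.FemtoCutoffLadderEventualTowerDominancePwTwoTowers
import Summits.QuantumFields.YangMills.Theorems.FemtoTransferGapBounds
import Summits.QuantumFields.YangMills.Theorems.FemtoTransferGapLevelsPos

/-! # Sub-skeleton «two-towers» of stub T = `EventualTowerDominancePw` (stmt-QuantumFields-25890) of line «dyadic-eventual» on crux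
`SubOctaveBounded` (stmt-QuantumFields-24085).  Planner ym-idea-1 g4's Sketch6 (evidence `line-two-towers-pw.lean` on 25890, 05:33Z), re-typed
by lead ym-line-fcl-p1 g9 against the ROUTE decl `Theses.FemtoCutoffLadder.EventualTowerDominancePw` (rev 16) instead of a local copy; the glue
theorems of Sketch6 are in the tree (`eventualSplitGluePw_proof`, p607240).  Two stubs: `SelfTowerFrequentlyPw` (lower direction along the own
tower of EVERY base, frequently in height, `CΛ²` allowance) and `CrossTowerAgreementPw` (one-sided universality of the femto-gap VALUE across
towers at infinite height — uniqueness-type, XL); composition landed in the tree (`eventualTowerDominancePw_of_selfTower_of_crossTower`, lead g9 p613278).  REGISTERED as the skeleton «two-towers»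
of 25890 (stubs `stub_selfTowerFrequentlyPw`, `stub_crossTowerAgreementPw`); on 24085 the registered stub is T by name.
R2b1 is a RECORD rung; no summit is proved here. -/

/-! ## two-towers skeleton, pointwise typing -/
namespace Summit.QuantumFields.YangMills.Cruxes.EventualTowerDominancePw.TwoTowers

open Summit.QuantumFields.YangMills.Theorems.FemtoTransferGap
open Summit.QuantumFields.YangMills.Theorems.FemtoCutoffLadder
open Summit.QuantumFields.YangMills.Theses.FemtoCutoffLadder

/-- Stub 1 (ONE tower; LOWER direction along the own tower of EVERY base `L' ≥ L₀`, frequently in height, `CΛ²` allowance;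
pointwise: `j` after `β'`). NOTE: this re-widens the lower tower comparison of `OctaveStepDecay` (one base) to all bases, but only
at SOME heights and rate-free. -/
def SelfTowerFrequentlyPw : Prop :=
  ∃ (C lam0 : ℝ) (L0 : ℕ), 0 < lam0 ∧ ∀ lam : ℝ, 0 < lam → lam ≤ lam0 → ∀ (L' : ℕ) [NeZero L'], L0 ≤ L' →
    ∀ β' : ℝ, InFemtoWindow lam β' L' → ∀ ε : ℝ, 0 < ε → ∀ j0 : ℕ, ∃ j : ℕ, j0 ≤ j ∧ ∀ (N : ℕ) [NeZero N], N = L' * 2 ^ j →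
      ∀ βN : ℝ, InFemtoWindow lam βN N → luscherLambda βN N = luscherLambda β' L' →
        secondValue su2Rep N βN ^ N * topValue su2Rep L' β' ^ L' ≤
          Real.exp (C * luscherLambda βN N ^ 2 + ε) * (secondValue su2Rep L' β' ^ L' * topValue su2Rep N βN ^ N)

/-- Stub 2 (TWO towers agree at infinite height, one-sided, no `Λ²`: UNIVERSALITY OF THE VALUE of the femto gap across
regularisation towers — a uniqueness-type statement, XL; pointwise: `k` after `βN`). -/
def CrossTowerAgreementPw : Prop :=
  ∃ (lam0 : ℝ) (L0 : ℕ), 0 < lam0 ∧ ∀ lam : ℝ, 0 < lam → lam ≤ lam0 → ∀ (L' : ℕ) [NeZero L'] (L : ℕ) [NeZero L],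
    L0 ≤ L' → L' ≤ L → L < 2 * L' → ∀ ε : ℝ, 0 < ε → ∃ j0 : ℕ, ∀ j : ℕ, j0 ≤ j → ∀ (N : ℕ) [NeZero N], N = L' * 2 ^ j →
      ∀ βN : ℝ, InFemtoWindow lam βN N → ∃ k : ℕ, ∀ (M : ℕ) [NeZero M], M = L * 2 ^ k → ∀ βM : ℝ,
        InFemtoWindow lam βM M → luscherLambda βM M = luscherLambda βN N →
          secondValue su2Rep M βM ^ M * topValue su2Rep N βN ^ N ≤
            Real.exp ε * (secondValue su2Rep N βN ^ N * topValue su2Rep M βM ^ M)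

/-- stub 1 (XL): lower direction along the own tower of EVERY base, frequently in height, `CΛ²` allowance. -/
theorem stub_selfTowerFrequentlyPw : SelfTowerFrequentlyPw := by
  sorry

/-- stub 2 (HARDEST, XL): one-sided universality of the femto-gap VALUE across towers at infinite height. -/
theorem stub_crossTowerAgreementPw : CrossTowerAgreementPw := by
  sorry

/-- ★ The crux child `EventualTowerDominancePw` (stmt-QuantumFields-25890) BY NAME from exactly the two declared stubs. -/
theorem EventualTowerDominancePw_holds_of_stubs : EventualTowerDominancePw :=
  eventualTowerDominancePw_of_selfTower_of_crossTower stub_selfTowerFrequentlyPw stub_crossTowerAgreementPw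

end Summit.QuantumFields.YangMills.Cruxes.EventualTowerDominancePw.TwoTowers
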